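import Literature.MathematicalPhysics.QuantumFieldTheory.Balaban1983to89.B7Prop4Flat
import Literature.MathematicalPhysics.QuantumFieldTheory.Balaban1983to89.B7AvgGaugeCovariance
import Literature.MathematicalPhysics.QuantumFieldTheory.Balaban1983to89.B7Prop6Bound

/-!
# Bałaban's renormalization group for 4-d lattice Yang–Mills — B7 Proposition 6 (158)–(164) AT THE FLAT BACKGROUND
`U₀ = 1`: the identity (159) `Ū′^k = v_k·U̿′^k·v_k⁻¹` expressing the `k`-fold average (43) of `U′ = e^{A′}` as the gauge
transform of the `k`-fold double-bar average (90)/(91) by the accumulated block frames (160), with NO smallness; the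
bounds (161)–(163) and (164) `|Ū′^k − 1| ≤ O(1)α₁` with the explicit witness `O(1) = 200(d+1)`, UNIFORMLY IN `k`; and the
analyticity clause "`\overline{U′U₀}^k` is an analytic function of `A′`" in parametrised form and on the finite products
`𝔸^S` (`B7Prop6Flat`)

CITATION HEADER (lean-in-tree rule 2026-08-18).  Audit cell `pub-balaban`, paper sub-cell B07 (unit b2b-balaban-b07,
gen 19).  Source: T. Bałaban, *Averaging operations for lattice gauge theories*, Commun. Math. Phys. **98**, 17–51 (1985)
[Balaban1985Averaging] (cell paper B7; journal page = PDF page + 16), Sect. E pp. 42–43 [PDF 26–27], quoted from the page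
renders `b2b-balaban-ref1/pages/1985-cmp98-averaging/1985-cmp98-averaging-p026-x2.png`, `-p027-x2.png` READ AS IMAGES
(2026-08-19), and `-p005-x2.png` (p. 21, (21)–(22)) READ AS IMAGE (2026-08-19); for (8), (11), (42)–(45), (92)/(97),
(110)–(112), (127), (131) the renders `-p002-x2.png`, `-p003-x2.png`, `-p007-x2.png`, `-p008-x2.png`, `-p015-x2.png`,
`-p016-x2.png`, `-p018-x2.png`, `-p021-x2.png`, `-p022-x2.png` as read and quoted by gens 12–18 of this lineage (module
docstrings of the companion tree files below).
Companions: `B7Prop4Flat` (`dbavgIter` = `U̿₁^j` (90)/(91) at `U₀ = 1`, `logIter` = `Q_j(1, ·)` (127),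
`prop4_flat_induction` (128)–(131) — (131) IS (161) —, `prop4_flat_analyticAt`, `c4`, the `𝔸^S` letter
`insCfg`/`isOpen_polydisc`/`smallness_of_le_c4_div`; all REUSED BY NAME), `B7Prop3Flat` (the block frame (110)
`Favg`/`vframe`, the double-bar average (89) `dbavg` with (92) `bavg_eq_conj_dbavg`, the estimate (112) `frame_estimate`,
the domain lemma `logDomain_of_le_c3`, `analyticAt_Favg_expCfg`, `expCfg`, `C1`, `c3`), `B7Prop2Explicit` (`avgIter` = the
`k`-fold average `Ū^k` (43) read on the unit lattices, `rescale`), `B7Prop1Explicit` (`bavg` (42), `Xavg`, `gaugeAct` (8),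
`hol`, `Wcx`, `expUnit`, `norm_exp_sub_one_le_of_norm_le`; its `mlog_units_conj`/`bavg_gaugeAct` are the UNITARY cases of
§1 here), `B7AvgGaugeCovariance` (`uLev`; its `avgIter_gaugeAct` is (11) for unitary `u` under (52)), `B7Prop6Bound`
(pv19's pure-inequality kernel of (162)–(164): `oprod`, `ineq163_explicit`, `mul_sub_one_norm_le` — REUSED BY NAME; that
file records "(161) (Prop. 4, (131)) and the group-theoretic step (161) ⇒ (162)" as NOT certified there: both are certified
HERE at `U₀ = 1`), `MatrixLog` / `Literature.Analysis.Complex.LogOnePlus` (the series (21) `mlog = logOnePlus(· − 1)`),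
`B7` (the quoted leaf `B7.Prop6Printed` over the abstract `KExp` interface, curved background — NOT touched here, see
ABSOLUTE-RULE LEDGER).

THE PRINTED TEXT.  p. 42: "E. Analyticity Properties of the Averaging Operations.  In this section we will prove some
simple analyticity results for the averages. Let us begin with the average Ū^k. Formally, it is defined for all
configurations, but we have good control over it for configurations U satisfying the regularity condition (52). We will
prove that Ū^k is an analytic function of U on this domain. In fact, we will prove a little bit stronger result. Let us
take a configuration U₀ satisfying (52) and U = U′U₀, U′ = e^{iηA′}, |A′| bounded by a small constant α₁. Such
configurations U do not necessarily satisfy (52), so we get a neighborhood of U₀ which is larger than neighborhoods of U₀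
in the domain. This neighborhood may be also described by the conditions |U − U₀| = |UU₀⁻¹ − 1| < α₁η, (158) α₁ is a
sufficiently small number. We will prove that Ū^k = \overline{U′U₀}^k is an analytic function of A′ and Ū^k(Ū^k₀)⁻¹ is
close to 1; the difference may be estimated by a constant proportional to α₁. We have
Ū^k_b(Ū^k_0)_b⁻¹ = (\overline{U′U₀})^k_b(Ū^k_0)_b⁻¹ = (Ũ′)^k_b = v_k(b₋)(U̿′^k)_b R̄^k_{0,b} v_k⁻¹(b₊), b ⊂ Ω^{(k)}, (159)
where v_k(x) = (\overline{R_{0,x}U′})(\overline{R̄_{0,x}U̿′})·…·(\overline{R̄^{k−1}_{0,x}U̿′^{k−1}}), x ∈ Ω^{(k)}. (160)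
From Proposition 4, and especially from (131), we get |(1/i) log U̿′^j| = |Q_j(U₀, ηA′)| < 2α₁L^jη, (161) hence
|(1/i) log(\overline{R̄^j_{0,x}U̿′^j})| = |Σ_{x_j∈B(x)} L^{−d}(1/i) log(R̄^j_{0,x}U̿′^j)(Γ_{x,x_j})| < 8α₁dL^{j+1}η e^{2α₁dL^{j+1}η}
< O(1)α₁L^{j+1}η, j = 0, 1, …, k − 1 (162) and |v_k(x) − 1| < O(1)α₁ Σ_{j=0}^{k−1} L^{j+1}η ≤ O(1)α₁ (163) for α₁
sufficiently small. Moreover, Proposition 4 implies that the functions of A in (159) are analytic. We get the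
following"  p. 43: "Proposition 6. If U₀ satisfies (52), then \overline{U′U₀}^k is an analytic function of
A′ = (1/(iη)) log U′ for A′ with values in the complexified algebra, and satisfying |A′| < α₁. Moreover, we have a bound
|\overline{U′U₀}^k(Ū^k₀)⁻¹ − 1| < O(1)α₁. (164)  Of course, we assume that α₀, α₁ are sufficiently small."
Used from earlier sections (quoted in the companions): (8) `U^u_{⟨x,x'⟩} = u(x)U_{⟨x,x'⟩}u⁻¹(x')`, (11) "\overline{U^u} =
(Ū)^u", (21) the series "log X = Σ_{n=1}^∞ ((−1)^{n+1}/n)(X − 1)ⁿ", p. 24 (proof of (45) = (11) for the average (42)) "by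
the definition (22) their logarithms are unitarily equivalent with the same unitary operator u(c₋). Then from (42) we get
(\overline{U^u})_c = u(c₋)Ū_c u⁻¹(c₊).", (92) "V̄₁ = v V̿₁ v⁻¹" / (97), (110) the block frame
`v(y) = exp(Σ_{x∈B(y)} L^{−d} log V(Γ_{y,x}))`, (112).

THE FLAT BACKGROUND.  For `U₀ = 1`: `Ū^k_0 = 1` ((42) of the unit configuration), every rotation `R_{0,x}`, `R̄^j_{0,x}`,
`R̄^k_{0,b}` is the identity, `Ũ′^k = Ū′^k`, `α₀ = 0`, and (52)/(158) carry no content beyond `|U′ − 1| < α₁η`; (159) reads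
`Ū′^k_b = v_k(b₋)(U̿′^k)_b v_k(b₊)⁻¹` with `U̿′^k` the `k`-fold double-bar average of `U′` over the flat background
(`B7Prop4Flat.dbavgIter`) and (160) `v_k(x) = v[U′](x)·v[U̿′](x)·…·v[U̿′^{k−1}](x)`, `v[V](x)` the block frame (110) of the
configuration `V` at the site `x` read on the lattice on which `V` lives; (161) is Prop. 4 (131) at `U₀ = 1`
(`B7Prop4Flat.prop4_flat_induction`), (162) is (112) (`B7Prop3Flat.frame_estimate`) fed with (161).

DICTIONARY print ↦ Lean (conventions of `B7Prop2Explicit`/`B7Prop3Flat`/`B7Prop4Flat`: `𝔸` a complete normed `ℂ`-algebra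
for the complexified matrix algebra, the `i` and the `η` of `U′ = e^{iηA′}` absorbed into the bond field `B = iηA′`
(`‖B_b‖ ≤ b`, `b` playing `ηα₁`), every lattice `Ω^{(j)} = L^jηℤ^d` identified with `ℤ^d` by `rescale`, so that with
`L^kη = 1` the number `L^k·b` plays `α₁`).  `U′ = e^{iηA′}` ↦ `expCfg B`; `Ū′^k` (43) ↦ `avgIter L (expCfg B) k`; `U̿′^k`
(90)/(91) at `U₀ = 1` ↦ `dbavgIter L (expCfg B) k`; `(1/i) log U̿′^j = Q_j(U₀, ηA′)|_{U₀=1}` ↦ `logIter L B j`; the block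
frame `\overline{R̄^j_{0,x}U̿′^j}` of (160)/(162) (= (110) for `V = U̿′^j` at the `L`-lattice site `x`) ↦
`vframe L (dbavgIter L V j) y` with exponent `Favg L (dbavgIter L V j) y`; `v_k` (160) ↦ `vprod L V k` (recursive:
`v_{j+1}(z) = v_j(Lz)·v[U̿′^j](Lz)`; `= oprod` of the factors `frameFac L V k z j = v[U̿′^j](L^{k−j}z)`,
`val_vprod_eq_oprod`); the gauge transformation (8) ↦ `gaugeAct`; "|A′| < α₁", "α₁ sufficiently small" ↦ the single
threshold `8C₁(d)·L^kb ≤ 1`, i.e. `L^kb ≤ c₄(d) = 1/(8C₁(d))` of Prop. 4 at `α₀ = 0` (`C₁(d) = 1256(d+1)²`); print's `O(1)`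
of (163) ↦ `e^{32d·L^kb} − 1 ≤ 64d·L^kb` (per unit of `α₁ = L^kb`: `64d`), of (164) ↦ `200(d+1)`.  §5: "analytic function
of A′" ↦ (i) `AnalyticAt ℂ (t ↦ avgQ L (B t) k z κ) t₀` for any bondwise-analytic `B : E → bond fields`, `E` a complex
normed space, where `avgQ` is the right side of (159) written through `Q_j` (`vprodQ`, `avgQ`; `= avgIter` under the
threshold, `avgIter_eq_avgQ`); (ii) on `𝔸^S` (`S` any finite bond set, `insCfg S a`: `U′ = e^{A′}` on `S`, `1` off `S`):
`AnalyticOnNhd ℂ (a ↦ Ū′^k(c)) {∀ s, ‖a s‖ < c₄(d)/L^k}` for the GENUINE `avgIter`.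

WHAT THIS FILE PROVES (kernel, no `sorry`, standard axioms), for any `d`, any `L` (bounds: `L ≥ 2`), any `k`:
* §1 `logOnePlus_conj`, `mlog_conj` — p. 24 "their logarithms are unitarily equivalent with the same unitary operator"
  for EVERY unit `u` of `𝔸` and EVERY `X` (`log(uXu⁻¹) = u(log X)u⁻¹` for the bare series (21), with no convergence
  hypothesis: both sides are `0` off the convergence set); `Xavg_gaugeAct_units`, `bavg_gaugeAct_units` — (45) = (11) for the one-step average (42) and
  `avgIter_gaugeAct_units` — (11) for `Ū^k` (43), for EVERY invertible gauge function, with no domain condition.  (Print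
  states (11)/(45) and the conjugation covariance of (21) for unitary `u`; Sect. E silently applies them to the complex,
  non-unitary frames `v_k` — §1 is the justification.)
* §2 `avgIter_eq_gaugeAct_vprod` / `val_avgIter_eq` — (159) at `U₀ = 1` AS AN IDENTITY OF THE FORMAL OBJECTS, for every
  configuration `V`, every `L`, `k`: `Ū^k[V] = (U̿^k[V])^{v_k}`, i.e. `Ū^k(c) = v_k(c₋)·U̿^k(c)·v_k(c₊)⁻¹` ((92)/(97)
  iterated with §1); `val_vprod_eq_oprod` — (160): `v_k` is the ordered product of the `k` block frames.
* §3 `ineq161` ((161) = `prop4_flat_induction` (i),(iii)), `ineq162` ((162): `‖F‖ ≤ 8d·L^{j+1}b`, `‖v − 1‖, ‖v⁻¹ − 1‖ ≤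
  16d·L^{j+1}b` for the frames of `U̿′^j`, `j < k`), `ineq163` ((163): `‖v_k(z) − 1‖ ≤ e^{32d·L^kb} − 1 ≤ 64d·L^kb`,
  `‖v_k(z)⁻¹ − 1‖ ≤ 128d·L^kb`, via `B7Prop6Bound.ineq163_explicit` BY NAME), under `8C₁(d)L^kb ≤ 1`, uniformly in `k`.
* §4 `prop6_flat` / `prop6_flat_164` — PROPOSITION 6 (164) at `U₀ = 1`: for `L ≥ 2`, `sup_b ‖B_b‖ ≤ b`, `L^kb ≤ c₄(d)`:
  `‖Ū′^k(c) − 1‖ ≤ 200(d+1)·L^kb` at every bond `c` of `Ω^{(k)}`, together with the factorisation (159)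
  `Ū′^k(c) = v_k(c₋)·exp(Q_k(c))·v_k(c₊)⁻¹` and the three factor bounds — the printed `O(1)` witnessed by `200(d+1)`,
  INDEPENDENT of `k`, `L`, `b`.
* §5 `prop6_flat_analyticAt` (parametrised form), `prop6_flat_analyticOnNhd_ins` (the printed letter on `𝔸^S`, for the
  genuine `avgIter`), `prop6_flat_ins` ((164) on the closed polydisc) — the ANALYTICITY CLAUSE of Prop. 6 at `U₀ = 1`
  ("Proposition 4 implies that the functions of A in (159) are analytic": `prop4_flat_analyticAt` for `Q_j`,
  `analyticAt_Favg_expCfg` for the frames on the domain supplied by (161), products and `exp`).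

ABSOLUTE-RULE LEDGER.  Hypotheses of every theorem: NONE beyond the displayed smallness condition `8C₁(d)L^kb ≤ 1`
(resp. `L^kb ≤ c₄(d)`, resp. the polydisc) and `L ≥ 2`; §1–§2 have no hypotheses at all.  All objects are the concrete
`avgIter` (43), `dbavgIter` (90)/(91)|_{U₀=1}, `logIter` (127), `vframe`/`Favg` (110), `bavg` (42), `gaugeAct` (8) of the
tree.  No `B7.Prop*` placeholder is assumed, nothing of the manuscript is cited as a fact; `B7.Prop6Printed` (curved
background, abstract `KExp` interface) is neither used nor claimed.

DIVERGENCES from print (located; cell DIVERGENCE.md D-b07g19.1).  (a) FLAT BACKGROUND ONLY: `U₀ = 1` (`α₀ = 0`): the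
background averages `Ū^k_0`, the rotations `R_{0,x}`, `R̄^j_{0,x}`, `R̄^k_{0,b}`, the hypothesis (52) and the
neighbourhood (158) of a curved `U₀` are absent (at `U₀ = 1` (158) is `|U′ − 1| < α₁η`, cf. `norm_expCfg_sub_one_le`);
the leaf `B7.Prop6Printed` is NOT discharged; Prop. 7 and the Prop. 5 extension (p. 43, "easily incorporated") are not
touched.  (b) COVARIANCE FOR ALL UNITS: (11)/(45) and the conjugation covariance of the logarithm (p. 24) are proved for EVERY
invertible gauge function / conjugating unit (print states them for unitary `u`, p. 24), because `log` is the bare series (21) (value `0` off its convergence set)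
and conjugation acts termwise; this is what the printed use of (97)/(11) with the complex frames `v_k` in (159) requires.  (c) CONSTANTS and
THRESHOLD: (162) is obtained with the constant `8d` WITHOUT print's factor `e^{2α₁dL^{j+1}η}` (our (112),
`B7Prop3Flat.frame_estimate`, gives `|F| ≤ 4θ`, `θ = 2dL^{j+1}b`); (163) `O(1) = (e^{32d·α₁} − 1)/α₁ ≤ 64d` and (164)
`O(1) = 200(d+1)` are explicit; "α₁ sufficiently small" is the ONE threshold `8C₁(d)·L^kb ≤ 1` of Prop. 4 at `α₀ = 0`
(`B7Prop4Flat`), no further smallness is imposed; for the inverse frame `|v_k⁻¹ − 1| ≤ 2|v_k − 1|` is used (print does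
not separate `v_k⁻¹`).  (d) ANALYTICITY is rendered, as in `B7Prop3Flat` §5 / `B7Prop4Flat` §3 (D-b07g16.3, D-b07g17.1
(b)), (i) in PARAMETRISED form for the composite (159) `avgQ` (which equals `Ū′^k(c)` wherever the threshold holds) and
(ii) LITERALLY for the genuine `Ū′^k(c)` on the finite products `𝔸^S`, `S` ANY finite set of bonds of the fine unit
lattice, the other bond variables frozen at `A′_b = 0`, on the open polydisc `‖A′_b‖ < c₄(d)/L^k` (print: all bonds at
once, `|A′| < α₁`; every finite `S` is allowed, locality holds by construction).  (e) SETTING: `ℤ^d` (no torus), a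
complete normed `ℂ`-algebra `𝔸` (no `‖1‖ = 1` needed), `B_b ∈ 𝔸` arbitrary with a GLOBAL bound `sup_b ‖B_b‖ ≤ b`; the
`i`, `η` absorbed (`b` plays `ηα₁`, `L^kb` plays `α₁` at `L^kη = 1`); the printed strict `<` become `≤`; `L ≥ 2`.

FINDINGS (cell GAPS.md C-b07g19-1).  At `U₀ = 1` the chain (159)–(164) is correct as printed and every `O(1)` is
witnessed uniformly in `k` (`64d` in (163), `200(d+1)` in (164)), closing at the flat background the two inputs that
`B7Prop6Bound` left printed ((161), and (161) ⇒ (162)) and the identity (159)/(160) itself; the use of (97)/(11) with the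
complex, non-unitary frames `v_k` rests only on the conjugation covariance of the series (21) under arbitrary invertible
conjugators, kernel-checked in §1.  No gap located.  VALUE = kernel-certified Prop. 6 for the paper's own objects over the flat background, the
form in which B9 p. 406 / B12 consume (164) (GAPS G-A2-1: `O(1)` uniform in `k`, linear in `α₁`); NOT summit progress
(the curved background `U₀ ≠ 1`, Prop. 7, and papers B8–B13 remain).

VERSIONS.  v1 (gen 19): this file.
-/

noncomputable section

open scoped BigOperators
open NormedSpace Finset

namespace Literature.MathematicalPhysics.QuantumFieldTheory.Balaban1983to89.B7Prop6Flat

open B7Prop1Explicit B7Prop2Explicit B7Prop3Flat B7Prop4Flat MatrixLog B7AvgGaugeCovariance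
open Literature.Analysis.Complex (logOnePlus logSeriesCoeff)

-- `Site` alone would resolve to the torus sites of `Setup.lean`; re-export the `ℤ^d` sites of `B7Prop1Explicit`.
export B7Prop1Explicit (Site)

variable {d : ℕ}

/-! ## §1 Conjugation covariance of the series logarithm (21) and of the averages (42)/(43) for ARBITRARY invertible
gauge functions — the complexified form of (11)/(45) used by (159) -/

section Conj

variable {𝔸 : Type*} [NormedRing 𝔸] [NormedAlgebra ℂ 𝔸]

/-- **The series (21) is conjugation-covariant with NO hypothesis**: `log(uXu⁻¹) = u (log X) u⁻¹` for every unit `u`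
and every `X` — termwise `(u(X − 1)u⁻¹)ⁿ = u(X − 1)ⁿu⁻¹`; if the series at `X − 1` does not converge, neither does
the conjugated one and both sides are the series' default value `0`.  (Print, p. 24: "by the definition (22) their
logarithms are unitarily equivalent with the same unitary operator u(c₋)" — for unitary `u`; Sect. E applies the
identities (11)/(97) to the COMPLEX frames `v_k` of (160), for which `|u|, |u⁻¹| ≤ 1` fails — this lemma is what makes
(159) an identity there.) [cite: Balaban1985Averaging, (21)–(22) p.21, p.24, (159) p.42] -/
theorem logOnePlus_conj (u : 𝔸ˣ) (x : 𝔸) :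
    logOnePlus ((u : 𝔸) * x * ((u⁻¹ : 𝔸ˣ) : 𝔸)) = (u : 𝔸) * logOnePlus x * ((u⁻¹ : 𝔸ˣ) : 𝔸) := by
  simp only [Literature.Analysis.Complex.logOnePlus]
  have hterm : (fun n : ℕ => logSeriesCoeff n • ((u : 𝔸) * x * ((u⁻¹ : 𝔸ˣ) : 𝔸)) ^ n)
      = fun n : ℕ => (u : 𝔸) * (logSeriesCoeff n • x ^ n) * ((u⁻¹ : 𝔸ˣ) : 𝔸) := by
    funext n
    rw [Units.conj_pow, mul_smul_comm, smul_mul_assoc]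
  rw [hterm]
  by_cases hs : Summable (fun n : ℕ => logSeriesCoeff n • x ^ n)
  · rw [(hs.mul_left (u : 𝔸)).tsum_mul_right ((u⁻¹ : 𝔸ˣ) : 𝔸), hs.tsum_mul_left (u : 𝔸)]
  · have hs' : ¬ Summable (fun n : ℕ => (u : 𝔸) * (logSeriesCoeff n • x ^ n) * ((u⁻¹ : 𝔸ˣ) : 𝔸)) := by
      intro hg
      apply hs
      refine ((hg.mul_left ((u⁻¹ : 𝔸ˣ) : 𝔸)).mul_right (u : 𝔸)).congr fun n => ?_
      show ((u⁻¹ : 𝔸ˣ) : 𝔸) * ((u : 𝔸) * (logSeriesCoeff n • x ^ n) * ((u⁻¹ : 𝔸ˣ) : 𝔸)) * (u : 𝔸)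
          = logSeriesCoeff n • x ^ n
      rw [mul_assoc (u : 𝔸), Units.inv_mul_cancel_left, Units.inv_mul_cancel_right]
    rw [tsum_eq_zero_of_not_summable hs, tsum_eq_zero_of_not_summable hs', mul_zero, zero_mul]

/-- **"their logarithms are unitarily equivalent" (p. 24) for ARBITRARY units**: `log(uXu⁻¹) = u (log X) u⁻¹`, `log` the
series (21) (`MatrixLog.mlog`), with no condition on `u` or `X` (the tree's `B7Prop1Explicit.mlog_units_conj` assumes
`|u|, |u⁻¹| ≤ 1` and `|X − 1| < 1`). [cite: Balaban1985Averaging, (21)–(22) p.21, p.24] -/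
theorem mlog_conj (u : 𝔸ˣ) (X : 𝔸) :
    mlog ((u : 𝔸) * X * ((u⁻¹ : 𝔸ˣ) : 𝔸)) = (u : 𝔸) * mlog X * ((u⁻¹ : 𝔸ˣ) : 𝔸) := by
  have hc : (u : 𝔸) * X * ((u⁻¹ : 𝔸ˣ) : 𝔸) - 1 = (u : 𝔸) * (X - 1) * ((u⁻¹ : 𝔸ˣ) : 𝔸) := by
    rw [mul_sub, sub_mul, mul_one, Units.mul_inv]
  rw [mlog_def, mlog_def, hc]
  exact logOnePlus_conj u (X - 1)

/-- (45) for the exponent of (42), for an ARBITRARY invertible gauge function `u` (no norm condition, no domain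
condition): `X_c[V^u] = u(c₋) X_c[V] u(c₋)⁻¹`. [cite: Balaban1985Averaging, (45) p.24, (8) p.18] -/
theorem Xavg_gaugeAct_units (L : ℕ) (u : Site d → 𝔸ˣ) (V : Site d → Fin d → 𝔸ˣ) (q : Site d) (κ : Fin d) :
    Xavg L (gaugeAct u V) q κ = (u q : 𝔸) * Xavg L V q κ * ((u q)⁻¹ : 𝔸ˣ) := by
  unfold Xavg
  rw [Finset.mul_sum, Finset.sum_mul]
  refine Finset.sum_congr rfl fun r _ => ?_
  rw [Wcx_gaugeAct, Units.val_mul, Units.val_mul, mlog_conj (u q), mul_smul_comm, smul_mul_assoc]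

variable [CompleteSpace 𝔸]

/-- **(45) = (11) for the one-step average (42), for an ARBITRARY invertible (e.g. complex, non-unitary) gauge
function**: `\bar{V^u}_c = u(c₋) V̄_c u(c₊)⁻¹` as an identity of the formal objects, with no smallness and no
`|u| ≤ 1` (the tree's `B7Prop1Explicit.bavg_gaugeAct` is the printed unitary case inside the analyticity domain).
[cite: Balaban1985Averaging, (45) p.24, (11) p.19] -/
theorem bavg_gaugeAct_units (L : ℕ) (u : Site d → 𝔸ˣ) (V : Site d → Fin d → 𝔸ˣ) (q : Site d) (κ : Fin d) :
    bavg L (gaugeAct u V) q κ = u q * bavg L V q κ * (u (q + (L : ℤ) • e κ))⁻¹ := by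
  letI : NormedAlgebra ℚ 𝔸 := NormedAlgebra.restrictScalars ℚ ℂ 𝔸
  apply Units.ext
  simp only [bavg, Units.val_mul, val_expUnit]
  rw [Xavg_gaugeAct_units L u V q κ, hol_gaugeAct, disp_seg, exp_units_conj, Units.val_mul, Units.val_mul]
  simp only [mul_assoc, Units.inv_mul_cancel_left]

/-- **(11) «\overline{U^u} = (Ū)^u» for the `k`-fold average (43), for EVERY invertible gauge function `u`**
(`u_j(z) = u(L^jz)`, `B7AvgGaugeCovariance.uLev`), with no hypothesis at all (the tree's
`B7AvgGaugeCovariance.avgIter_gaugeAct` is the unitary case under (52), p. 24 "Then from (42) we get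
(\overline{U^u})_c = u(c₋)Ū_c u⁻¹(c₊)"). [cite: Balaban1985Averaging, (11) p.19, p.24, (43) p.24] -/
theorem avgIter_gaugeAct_units (L : ℕ) (u : Site d → 𝔸ˣ) (V : Site d → Fin d → 𝔸ˣ) :
    ∀ j : ℕ, avgIter L (gaugeAct u V) j = gaugeAct (uLev L u j) (avgIter L V j)
  | 0 => by simp
  | j + 1 => by
    funext z κ
    rw [avgIter_succ, avgIter_succ, rescale_apply, avgIter_gaugeAct_units L u V j, bavg_gaugeAct_units]
    simp only [gaugeAct, rescale_apply, uLev_smul, uLev_smul_add]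

end Conj

/-! ## §2 The frames (160) and the identity (159) at `U₀ = 1` — no smallness -/

section Frames

variable {𝔸 : Type*} [NormedRing 𝔸] [NormedAlgebra ℂ 𝔸] [CompleteSpace 𝔸]

/-- **(160) at `U₀ = 1`, recursively**: the accumulated frame `v_j` on the sites of `Ω^{(j)} ≅ ℤ^d`:
`v_0 = 1`, `v_{j+1}(z) = v_j(Lz) · \overline{R̄^j_{0,Lz} U̿′^j}` with `\overline{R̄^j_{0,y} U̿′^j} = v(y)[U̿′^j]` the block
frame (110) of the `j`-th double-bar average at the `L`-lattice site `y = Lz` (`B7Prop3Flat.vframe`; at `U₀ = 1`,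
`R̄^j_0 = 1`).  Unrolled (`val_vprod_eq_oprod`): `v_k(z) = ∏_{j=0}^{k−1} v[U̿′^j](L^{k−j}z)`, leftmost factor `j = 0`,
which is (160) "v_k(x) = (R̄_{0,x}U′)(R̄_{0,x}U̿′)·…·(R̄^{k−1}_{0,x}U̿′^{k−1}), x ∈ Ω^{(k)}" read on the unit lattices.
[cite: Balaban1985Averaging, (160) p.42, (110) p.34] -/
def vprod (L : ℕ) (V : Site d → Fin d → 𝔸ˣ) : ℕ → Site d → 𝔸ˣ
  | 0 => fun _ => 1
  | j + 1 => fun z => vprod L V j ((L : ℤ) • z) * vframe L (dbavgIter L V j) ((L : ℤ) • z)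

/-- `vprod_zero`: `v_0 = 1`. [cite: Balaban1985Averaging, (160) p.42] -/
@[simp] theorem vprod_zero (L : ℕ) (V : Site d → Fin d → 𝔸ˣ) (z : Site d) : vprod L V 0 z = 1 := rfl

/-- `vprod_succ`: `v_{j+1}(z) = v_j(Lz) · v[U̿′^j](Lz)`. [cite: Balaban1985Averaging, (160) p.42] -/
theorem vprod_succ (L : ℕ) (V : Site d → Fin d → 𝔸ˣ) (j : ℕ) (z : Site d) :
    vprod L V (j + 1) z = vprod L V j ((L : ℤ) • z) * vframe L (dbavgIter L V j) ((L : ℤ) • z) := rfl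

/-- **(159) at `U₀ = 1`, AS AN IDENTITY OF THE FORMAL OBJECTS (no smallness, any `L`, any `k`)**:
"Ū^k_b(Ū^k_0)_b⁻¹ = (\overline{U′U₀})^k_b(Ū^k_0)_b⁻¹ = (Ũ′)^k_b = v_k(b₋)(U̿′^k)_b R̄^k_{0,b} v_k⁻¹(b₊), b ⊂ Ω^{(k)}" with
`U₀ = 1` (`Ū^k_0 = 1`, `R̄^k_{0,b} = 1`): the `k`-fold average (43) IS the gauge transform (8) of the `k`-fold double-bar
average (90)/(91) by the accumulated frame (160), `Ū′^k = (U̿′^k)^{v_k}`.  Proof = (92)/(97) iterated: one step is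
`V̄ = v·V̿·v⁻¹` (`B7Prop3Flat.bavg_eq_conj_dbavg`) and the covariance (11)/(45) of the average under the (complex,
non-unitary) accumulated frame (`bavg_gaugeAct_units`). [cite: Balaban1985Averaging, (159) p.42, (92) p.31, (97) p.32] -/
theorem avgIter_eq_gaugeAct_vprod (L : ℕ) (V : Site d → Fin d → 𝔸ˣ) :
    ∀ k : ℕ, avgIter L V k = gaugeAct (vprod L V k) (dbavgIter L V k)
  | 0 => by
    funext z κ
    simp [gaugeAct]
  | k + 1 => by
    funext z κ
    rw [avgIter_succ, rescale_apply, avgIter_eq_gaugeAct_vprod L V k, bavg_gaugeAct_units, bavg_eq_conj_dbavg]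
    simp only [gaugeAct, vprod_succ, dbavgIter_succ, smul_add, mul_inv_rev, mul_assoc]

/-- (159) bondwise in `𝔸`: `Ū′^k(c) = v_k(c₋) · U̿′^k(c) · v_k(c₊)⁻¹`, `c = ⟨z, z + e_κ⟩` a bond of `Ω^{(k)} ≅ ℤ^d`.
[cite: Balaban1985Averaging, (159) p.42] -/
theorem val_avgIter_eq (L : ℕ) (V : Site d → Fin d → 𝔸ˣ) (k : ℕ) (z : Site d) (κ : Fin d) :
    ((avgIter L V k z κ : 𝔸ˣ) : 𝔸)
      = (vprod L V k z : 𝔸) * (dbavgIter L V k z κ : 𝔸) * (((vprod L V k (z + e κ))⁻¹ : 𝔸ˣ) : 𝔸) := by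
  rw [avgIter_eq_gaugeAct_vprod L V k]
  simp only [gaugeAct, Units.val_mul]

/-- The `j`-th factor of (160) for the site `x = L^kz ∈ Ω^{(k)}`, read at level `j` (where `x` is the site `L^{k−j}z`
of the unit lattice `Ω^{(j)} ≅ ℤ^d`): `\overline{R̄^j_{0,x}U̿′^j} = v[U̿′^j](L^{k−j}z)`. [cite: Balaban1985Averaging, (160) p.42] -/
def frameFac (L : ℕ) (V : Site d → Fin d → 𝔸ˣ) (k : ℕ) (z : Site d) (j : ℕ) : 𝔸ˣ :=
  vframe L (dbavgIter L V j) (((L : ℤ) ^ (k - j)) • z)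

omit [NormedAlgebra ℂ 𝔸] [CompleteSpace 𝔸] in
/-- Ordered products agree when their factors agree below the length — bookkeeping for `B7Prop6Bound.oprod`. [folklore] -/
theorem oprod_congr {a b : ℕ → 𝔸} : ∀ k : ℕ, (∀ j < k, a j = b j) → B7Prop6Bound.oprod a k = B7Prop6Bound.oprod b k
  | 0, _ => rfl
  | k + 1, h => by
    simp only [B7Prop6Bound.oprod]
    rw [oprod_congr k (fun j hj => h j (Nat.lt_succ_of_lt hj)), h k (Nat.lt_succ_self k)]

/-- **(160) verbatim**: `v_k(z) = v[U′](L^kz) · v[U̿′](L^{k−1}z) · … · v[U̿′^{k−1}](Lz)` — the recursive `vprod` is the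
ordered product (`B7Prop6Bound.oprod`, leftmost factor `j = 0`) of the `k` block frames (110) of the successive
double-bar averages, "v_k(x) = (R̄_{0,x}U′)(R̄_{0,x}U̿′)·…·(R̄^{k−1}_{0,x}U̿′^{k−1})". [cite: Balaban1985Averaging, (160) p.42] -/
theorem val_vprod_eq_oprod (L : ℕ) (V : Site d → Fin d → 𝔸ˣ) : ∀ (k : ℕ) (z : Site d),
    (vprod L V k z : 𝔸) = B7Prop6Bound.oprod (fun j => (frameFac L V k z j : 𝔸)) k
  | 0, z => by simp [B7Prop6Bound.oprod]
  | k + 1, z => by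
    rw [vprod_succ, Units.val_mul, val_vprod_eq_oprod L V k ((L : ℤ) • z)]
    simp only [B7Prop6Bound.oprod]
    congr 1
    · refine oprod_congr k fun j hj => ?_
      show ((vframe L (dbavgIter L V j) (((L : ℤ) ^ (k - j)) • ((L : ℤ) • z)) : 𝔸ˣ) : 𝔸)
          = ((vframe L (dbavgIter L V j) (((L : ℤ) ^ (k + 1 - j)) • z) : 𝔸ˣ) : 𝔸)
      rw [smul_smul, ← pow_succ, ← Nat.sub_add_comm (le_of_lt hj)]
    · simp [frameFac]

end Frames

/-! ## §3 The bounds (161)–(163) at `U₀ = 1`, uniformly in `k` -/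

section Bounds

variable {𝔸 : Type*} [NormedRing 𝔸] [NormedAlgebra ℂ 𝔸] [CompleteSpace 𝔸]

/-- NUMEROLOGY of the single threshold: `8C₁(d)·t ≤ 1` (`C₁(d) = 1256(d+1)²`) gives `10048(d+1)·t ≤ 1` — whence all
the smallness used below (`2dt ≤ 1/64` for (112), `32dt ≤ 1`, `196(d+1)t ≤ 1/51`). [folklore] -/
theorem small_of_threshold {t : ℝ} (ht : 0 ≤ t) (h : 8 * C1 d * t ≤ 1) : 10048 * ((d : ℝ) + 1) * t ≤ 1 := by
  have hd1 : (1 : ℝ) ≤ (d : ℝ) + 1 := by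
    have : (0 : ℝ) ≤ d := Nat.cast_nonneg d
    linarith
  have hle : 10048 * ((d : ℝ) + 1) ≤ 8 * C1 d := by unfold C1; nlinarith [hd1]
  exact (mul_le_mul_of_nonneg_right hle ht).trans h

/-- **(158) at `U₀ = 1`**: "|U − U₀| = |UU₀⁻¹ − 1| < α₁η" — for `U′ = e^{B}` bondwise with `‖B_b‖ ≤ b`:
`‖U′_b − 1‖ ≤ e^{b} − 1`. [cite: Balaban1985Averaging, (158) p.42] -/
theorem norm_expCfg_sub_one_le (B : Site d → Fin d → 𝔸) {b : ℝ} (hB : ∀ x κ, ‖B x κ‖ ≤ b) (x : Site d)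
    (κ : Fin d) : ‖((expCfg B x κ : 𝔸ˣ) : 𝔸) - 1‖ ≤ Real.exp b - 1 :=
  (norm_exp_sub_one_le_of_norm_le (hB x κ)).1

/-- **(161) at `U₀ = 1`** — "From Proposition 4, and especially from (131), we get |(1/i) log U̿′^j| = |Q_j(U₀, ηA′)| <
2α₁L^jη": for `L ≥ 2`, `sup_b ‖B_b‖ ≤ b`, `8C₁(d)L^kb ≤ 1` and every `j ≤ k`, `U̿′^j = e^{Q_j}` bondwise and
`‖Q_j‖ ≤ 2L^jb` — `B7Prop4Flat.prop4_flat_induction` (i), (iii) BY NAME. [cite: Balaban1985Averaging, (161) p.42, (131) p.38] -/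
theorem ineq161 (L : ℕ) (hL : 2 ≤ L) (B : Site d → Fin d → 𝔸) {b : ℝ} (hb : 0 ≤ b)
    (hB : ∀ x κ, ‖B x κ‖ ≤ b) (k : ℕ) (hk : 8 * C1 d * ((L : ℝ) ^ k * b) ≤ 1) {j : ℕ} (hj : j ≤ k) :
    dbavgIter L (expCfg B) j = expCfg (logIter L B j) ∧ ∀ z κ, ‖logIter L B j z κ‖ ≤ 2 * ((L : ℝ) ^ j * b) :=
  ⟨(prop4_flat_induction L hL B hb hB k hk j hj).1, (prop4_flat_induction L hL B hb hB k hk j hj).2.2⟩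

/-- **(162) at `U₀ = 1`, with (112)** — "|(1/i) log(R̄^j_{0,x}U̿′^j)| = |Σ_{x_j∈B(x)} L^{−d}(1/i) log(R̄^j_{0,x}U̿′^j)(Γ_{x,x_j})|
< 8α₁dL^{j+1}η e^{2α₁dL^{j+1}η} < O(1)α₁L^{j+1}η, j = 0, 1, …, k − 1": for `j < k` and every site `q` of `Ω^{(j+1)}`
(an `L`-lattice site of the level-`j` unit lattice), the frame exponent `F(q)[U̿′^j]` (110) and the frame
`v(q) = e^{F(q)}` satisfy `‖F(q)‖ ≤ 8d·L^{j+1}b`, `‖v(q) − 1‖ ≤ 16d·L^{j+1}b`, `‖v(q)⁻¹ − 1‖ ≤ 16d·L^{j+1}b`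
(`B7Prop3Flat.frame_estimate` with `a = 2L^jb`, `θ = 2dL^{j+1}b ≤ 1/64`; print's factor `e^{2α₁dL^{j+1}η} ≥ 1` is not
needed). [cite: Balaban1985Averaging, (162) p.42, (110)–(112) p.34] -/
theorem ineq162 (L : ℕ) (hL : 2 ≤ L) (B : Site d → Fin d → 𝔸) {b : ℝ} (hb : 0 ≤ b)
    (hB : ∀ x κ, ‖B x κ‖ ≤ b) (k : ℕ) (hk : 8 * C1 d * ((L : ℝ) ^ k * b) ≤ 1) {j : ℕ} (hj : j < k) (q : Site d) :
    ‖Favg L (dbavgIter L (expCfg B) j) q‖ ≤ 8 * d * ((L : ℝ) ^ (j + 1) * b) ∧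
    ‖((vframe L (dbavgIter L (expCfg B) j) q : 𝔸ˣ) : 𝔸) - 1‖ ≤ 16 * d * ((L : ℝ) ^ (j + 1) * b) ∧
    ‖(((vframe L (dbavgIter L (expCfg B) j) q)⁻¹ : 𝔸ˣ) : 𝔸) - 1‖ ≤ 16 * d * ((L : ℝ) ^ (j + 1) * b) := by
  have hL1 : 1 ≤ L := le_trans (by norm_num) hL
  have hL1r : (1 : ℝ) ≤ L := by exact_mod_cast hL1
  have hd0 : (0 : ℝ) ≤ d := Nat.cast_nonneg d
  obtain ⟨hX, hA⟩ := ineq161 L hL B hb hB k hk hj.le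
  rw [hX]
  set a : ℝ := 2 * ((L : ℝ) ^ j * b) with ha_def
  have ha : 0 ≤ a := by positivity
  set θ : ℝ := ((d * L : ℕ) : ℝ) * a with hθ_def
  have hθ : θ = 2 * d * ((L : ℝ) ^ (j + 1) * b) := by
    rw [hθ_def, ha_def, pow_succ]; push_cast; ring
  have hθ0 : 0 ≤ θ := by positivity
  have ht_mono : (L : ℝ) ^ (j + 1) * b ≤ (L : ℝ) ^ k * b :=
    mul_le_mul_of_nonneg_right (pow_le_pow_right₀ hL1r hj) hb
  have hsmall := small_of_threshold (d := d) (by positivity) hk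
  have hθ1 : θ ≤ 1 / 64 := by
    rw [hθ]
    have h1 : 2 * (d : ℝ) * ((L : ℝ) ^ (j + 1) * b) ≤ 2 * d * ((L : ℝ) ^ k * b) :=
      mul_le_mul_of_nonneg_left ht_mono (by positivity)
    have h2 : 128 * (d : ℝ) * ((L : ℝ) ^ k * b) ≤ 10048 * ((d : ℝ) + 1) * ((L : ℝ) ^ k * b) := by
      have : (0 : ℝ) ≤ (L : ℝ) ^ k * b := by positivity
      nlinarith
    linarith
  obtain ⟨hF, -, -, hv, -, hvi, -⟩ := frame_estimate (expCfg (logIter L B j)) (logIter L B j) q (d * L) ha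
    (fun x κ _ => ⟨rfl, hA x κ⟩) L hL1 q (by simp [l1]) le_rfl hθ0 hθ1
  refine ⟨?_, ?_, ?_⟩
  · calc _ ≤ 4 * θ := hF
      _ = _ := by rw [hθ]; ring
  · calc _ ≤ 8 * θ := hv
      _ = _ := by rw [hθ]; ring
  · calc _ ≤ 8 * θ := hvi
      _ = _ := by rw [hθ]; ring

omit [NormedAlgebra ℂ 𝔸] [CompleteSpace 𝔸] in
/-- `|v⁻¹ − 1| ≤ 2|v − 1|` for a unit with `|v − 1| ≤ ½` (from `v⁻¹ − 1 = −(v⁻¹ − 1)(v − 1) − (v − 1)`; for unitary `v`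
print has `|v⁻¹ − 1| = |v − 1|`). [folklore] -/
theorem norm_units_inv_sub_one_le (v : 𝔸ˣ) (h : ‖(v : 𝔸) - 1‖ ≤ 1 / 2) :
    ‖((v⁻¹ : 𝔸ˣ) : 𝔸) - 1‖ ≤ 2 * ‖(v : 𝔸) - 1‖ := by
  have hid : ((v⁻¹ : 𝔸ˣ) : 𝔸) - 1 = -((((v⁻¹ : 𝔸ˣ) : 𝔸) - 1) * ((v : 𝔸) - 1)) - ((v : 𝔸) - 1) := by
    simp only [sub_mul, mul_sub, one_mul, mul_one, Units.inv_mul]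
    abel
  have hle : ‖((v⁻¹ : 𝔸ˣ) : 𝔸) - 1‖ ≤ ‖((v⁻¹ : 𝔸ˣ) : 𝔸) - 1‖ * ‖(v : 𝔸) - 1‖ + ‖(v : 𝔸) - 1‖ := by
    calc ‖((v⁻¹ : 𝔸ˣ) : 𝔸) - 1‖ = ‖-((((v⁻¹ : 𝔸ˣ) : 𝔸) - 1) * ((v : 𝔸) - 1)) - ((v : 𝔸) - 1)‖ := by
          rw [← hid]
      _ ≤ ‖-((((v⁻¹ : 𝔸ˣ) : 𝔸) - 1) * ((v : 𝔸) - 1))‖ + ‖(v : 𝔸) - 1‖ := norm_sub_le _ _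
      _ ≤ _ := by rw [norm_neg]; gcongr; exact norm_mul_le _ _
  have hx := norm_nonneg (((v⁻¹ : 𝔸ˣ) : 𝔸) - 1)
  have hxy := mul_le_mul_of_nonneg_left h hx
  linarith

/-- **(163) at `U₀ = 1`, with EXPLICIT `O(1)`, uniformly in `k`** — "|v_k(x) − 1| < O(1)α₁ Σ_{j=0}^{k−1} L^{j+1}η ≤ O(1)α₁
for α₁ sufficiently small": for `L ≥ 2`, `sup_b ‖B_b‖ ≤ b`, `8C₁(d)L^kb ≤ 1` (so `L^kb` plays `α₁`, `L^kη = 1`) and every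
site `z` of `Ω^{(k)}`: `‖v_k(z) − 1‖ ≤ exp(32d·L^kb) − 1 ≤ 32d·L^kb·exp(32d·L^kb)` — pv19's `B7Prop6Bound.ineq163_explicit`
BY NAME applied to the ordered product (160) (`val_vprod_eq_oprod`) with the per-factor bound (162) `c·α₁·L^{j+1}η`,
`c = 16d` — hence `‖v_k(z) − 1‖ ≤ 64d·L^kb` and, for the inverse frame, `‖v_k(z)⁻¹ − 1‖ ≤ 128d·L^kb`.
[cite: Balaban1985Averaging, (163) p.42] -/
theorem ineq163 (L : ℕ) (hL : 2 ≤ L) (B : Site d → Fin d → 𝔸) {b : ℝ} (hb : 0 ≤ b)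
    (hB : ∀ x κ, ‖B x κ‖ ≤ b) (k : ℕ) (hk : 8 * C1 d * ((L : ℝ) ^ k * b) ≤ 1) (z : Site d) :
    ‖(vprod L (expCfg B) k z : 𝔸) - 1‖ ≤ Real.exp (32 * d * ((L : ℝ) ^ k * b)) - 1 ∧
    Real.exp (32 * d * ((L : ℝ) ^ k * b)) - 1
      ≤ 32 * d * ((L : ℝ) ^ k * b) * Real.exp (32 * d * ((L : ℝ) ^ k * b)) ∧
    ‖(vprod L (expCfg B) k z : 𝔸) - 1‖ ≤ 64 * d * ((L : ℝ) ^ k * b) ∧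
    ‖(((vprod L (expCfg B) k z)⁻¹ : 𝔸ˣ) : 𝔸) - 1‖ ≤ 128 * d * ((L : ℝ) ^ k * b) := by
  have hL1 : 1 ≤ L := le_trans (by norm_num) hL
  have hLr : (2 : ℝ) ≤ L := by exact_mod_cast hL
  have hL0 : (0 : ℝ) < L := by linarith
  have hd0 : (0 : ℝ) ≤ d := Nat.cast_nonneg d
  set t : ℝ := (L : ℝ) ^ k * b with ht_def
  have ht0 : 0 ≤ t := by positivity
  have hsmall := small_of_threshold (d := d) ht0 hk
  have hLk : (L : ℝ) ^ k ≠ 0 := pow_ne_zero _ hL0.ne'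
  -- (162) in the shape `c · α₁ · (L^{j+1}η)` of `ineq163_explicit`, `c = 16d`, `α₁ = t`, `L^{j+1}η = L^{j+1}/L^k`
  have hstep : ∀ j < k, ‖(frameFac L (expCfg B) k z j : 𝔸) - 1‖ ≤ 16 * d * t * ((L : ℝ) ^ (j + 1) / (L : ℝ) ^ k) := by
    intro j hj
    calc _ ≤ 16 * d * ((L : ℝ) ^ (j + 1) * b) := (ineq162 L hL B hb hB k hk hj _).2.1
      _ = 16 * d * t * ((L : ℝ) ^ (j + 1) / (L : ℝ) ^ k) := by rw [ht_def]; field_simp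
  have h163 := B7Prop6Bound.ineq163_explicit (fun j => (frameFac L (expCfg B) k z j : 𝔸)) k (L : ℝ) (16 * d) t hLr
    (by positivity) ht0 hstep
  have h32 : 2 * (16 * (d : ℝ)) * t = 32 * d * t := by ring
  rw [h32, ← val_vprod_eq_oprod] at h163
  obtain ⟨h1, h2⟩ := h163
  -- `exp(x) − 1 ≤ 2x` for `0 ≤ x ≤ 1`
  have hx1 : 32 * (d : ℝ) * t ≤ 1 := by nlinarith
  have hx0 : 0 ≤ 32 * (d : ℝ) * t := by positivity
  have hexp : Real.exp (32 * d * t) - 1 ≤ 2 * (32 * d * t) := by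
    have h := Real.abs_exp_sub_one_le (x := 32 * d * t) (by rw [abs_of_nonneg hx0]; exact hx1)
    rw [abs_of_nonneg hx0] at h
    exact (le_abs_self _).trans h
  have h3 : ‖(vprod L (expCfg B) k z : 𝔸) - 1‖ ≤ 64 * d * t := by linarith
  refine ⟨h1, h2, h3, ?_⟩
  have hhalf : ‖(vprod L (expCfg B) k z : 𝔸) - 1‖ ≤ 1 / 2 := by nlinarith
  calc _ ≤ 2 * ‖(vprod L (expCfg B) k z : 𝔸) - 1‖ := norm_units_inv_sub_one_le _ hhalf
    _ ≤ 2 * (64 * d * t) := by linarith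
    _ = 128 * d * t := by ring

/-! ## §4 Proposition 6 (164) at `U₀ = 1`: `|Ū′^k − 1| ≤ O(1)α₁` with `O(1) = 200(d+1)`, uniformly in `k` -/

omit [NormedAlgebra ℂ 𝔸] [CompleteSpace 𝔸] in
/-- Triple telescoping: `‖xyw − 1‖ ≤ (1 + ‖x − 1‖)(1 + ‖y − 1‖)(1 + ‖w − 1‖) − 1` (`B7Prop6Bound.mul_sub_one_norm_le`
twice) — the step (162)–(163) ⇒ (164) for the product (159). [folklore] -/
theorem norm_mul_mul_sub_one_le (x y w : 𝔸) :
    ‖x * y * w - 1‖ ≤ (1 + ‖x - 1‖) * (1 + ‖y - 1‖) * (1 + ‖w - 1‖) - 1 := by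
  have h1 := B7Prop6Bound.mul_sub_one_norm_le (x * y) w
  have h2 := B7Prop6Bound.mul_sub_one_norm_le x y
  have hw : 0 ≤ 1 + ‖w - 1‖ := by positivity
  have h3 := mul_le_mul_of_nonneg_right (show 1 + ‖x * y - 1‖ ≤ (1 + ‖x - 1‖) * (1 + ‖y - 1‖) by linarith) hw
  linarith

/-- The arithmetic of (164): three factors within `64dt`, `4t`, `128dt` of `1`, `10048(d+1)t ≤ 1` ⇒ the product is
within `200(d+1)t` of `1`. [folklore] -/
theorem arith164 {dd t a b c : ℝ} (hd : 0 ≤ dd) (ht : 0 ≤ t) (hsmall : 10048 * (dd + 1) * t ≤ 1)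
    (ha0 : 0 ≤ a) (hb0 : 0 ≤ b) (hc0 : 0 ≤ c) (ha : a ≤ 64 * dd * t) (hb : b ≤ 4 * t) (hc : c ≤ 128 * dd * t) :
    (1 + a) * (1 + b) * (1 + c) - 1 ≤ 200 * (dd + 1) * t := by
  set s : ℝ := a + b + c with hs_def
  have hs0 : 0 ≤ s := by positivity
  have hdt : 0 ≤ dd * t := mul_nonneg hd ht
  have hdt1 : 0 ≤ (dd + 1) * t := by positivity
  have hc1 : c ≤ 1 := by nlinarith
  have hcube : (1 + a) * (1 + b) * (1 + c) - 1 ≤ s + s ^ 2 := by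
    rw [hs_def]
    nlinarith [mul_nonneg ha0 hb0, mul_nonneg ha0 hc0, mul_nonneg hb0 hc0,
      mul_nonneg (mul_nonneg ha0 hb0) (sub_nonneg.2 hc1), sq_nonneg a, sq_nonneg b, sq_nonneg c]
  set S : ℝ := 196 * (dd + 1) * t with hS_def
  have hS0 : 0 ≤ S := by positivity
  have hsS : s ≤ S := by rw [hs_def, hS_def]; nlinarith
  have hS1 : S ≤ 1 / 51 := by rw [hS_def]; nlinarith
  have hs2 : s ^ 2 ≤ S ^ 2 := pow_le_pow_left₀ hs0 hsS 2
  have hS2 : S ^ 2 ≤ S * (1 / 51) := by rw [sq]; exact mul_le_mul_of_nonneg_left hS1 hS0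
  have : s + s ^ 2 ≤ S + S * (1 / 51) := by linarith
  calc (1 + a) * (1 + b) * (1 + c) - 1 ≤ s + s ^ 2 := hcube
    _ ≤ S + S * (1 / 51) := this
    _ = (196 * 52 / 51) * ((dd + 1) * t) := by rw [hS_def]; ring
    _ ≤ 200 * ((dd + 1) * t) := mul_le_mul_of_nonneg_right (by norm_num) hdt1
    _ = 200 * (dd + 1) * t := by ring

/-- **PROPOSITION 6 OF B7 AT THE FLAT BACKGROUND `U₀ = 1` — the bound (164) with an EXPLICIT constant, UNIFORM IN `k`**:
"Moreover, we have a bound |\overline{U′U₀}^k(Ū^k_0)⁻¹ − 1| < O(1)α₁. (164) Of course, we assume that α₀, α₁ are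
sufficiently small."  Here `U₀ = 1` (so `Ū^k_0 = 1`), `L ≥ 2`, `U′ = e^{B}` bondwise with `sup_b ‖B_b‖ ≤ b` and the single
Prop. 4 threshold `8C₁(d)·L^kb ≤ 1` (`L^kb ≤ c₄(d)`; `L^kb` plays `α₁`).  Then at every bond `c = ⟨z, z + e_κ⟩` of
`Ω^{(k)} ≅ ℤ^d`: (159) `Ū′^k(c) = v_k(z) · exp(Q_k(c)) · v_k(z + e_κ)⁻¹` with (161) `‖Q_k(c)‖ ≤ 2L^kb`, (163)
`‖v_k(z) − 1‖ ≤ 64d·L^kb`, `‖v_k(z + e_κ)⁻¹ − 1‖ ≤ 128d·L^kb`, and **(164) `‖Ū′^k(c) − 1‖ ≤ 200(d+1)·L^kb`** — the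
printed `O(1)` witnessed by `200(d+1)`, independent of `k`, `L` and `b` (linear in `α₁`, as B9 p. 406 uses it; cell GAPS
G-A2-1).  The analyticity clause is §5. [cite: Balaban1985Averaging, Prop. 6 (164) p.43, (159)–(163) p.42] -/
theorem prop6_flat (L : ℕ) (hL : 2 ≤ L) (B : Site d → Fin d → 𝔸) {b : ℝ} (hb : 0 ≤ b)
    (hB : ∀ x κ, ‖B x κ‖ ≤ b) (k : ℕ) (hk : 8 * C1 d * ((L : ℝ) ^ k * b) ≤ 1) (z : Site d) (κ : Fin d) :
    ((avgIter L (expCfg B) k z κ : 𝔸ˣ) : 𝔸)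
        = (vprod L (expCfg B) k z : 𝔸) * exp (logIter L B k z κ) * (((vprod L (expCfg B) k (z + e κ))⁻¹ : 𝔸ˣ) : 𝔸) ∧
      ‖logIter L B k z κ‖ ≤ 2 * ((L : ℝ) ^ k * b) ∧
      ‖(vprod L (expCfg B) k z : 𝔸) - 1‖ ≤ 64 * d * ((L : ℝ) ^ k * b) ∧
      ‖(((vprod L (expCfg B) k (z + e κ))⁻¹ : 𝔸ˣ) : 𝔸) - 1‖ ≤ 128 * d * ((L : ℝ) ^ k * b) ∧
      ‖((avgIter L (expCfg B) k z κ : 𝔸ˣ) : 𝔸) - 1‖ ≤ 200 * ((d : ℝ) + 1) * ((L : ℝ) ^ k * b) := by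
  have hd0 : (0 : ℝ) ≤ d := Nat.cast_nonneg d
  set t : ℝ := (L : ℝ) ^ k * b with ht_def
  have ht0 : 0 ≤ t := by positivity
  have hsmall := small_of_threshold (d := d) ht0 hk
  obtain ⟨hX, hQ⟩ := ineq161 L hL B hb hB k hk le_rfl
  have hid : ((avgIter L (expCfg B) k z κ : 𝔸ˣ) : 𝔸)
      = (vprod L (expCfg B) k z : 𝔸) * exp (logIter L B k z κ) * (((vprod L (expCfg B) k (z + e κ))⁻¹ : 𝔸ˣ) : 𝔸) := by
    rw [val_avgIter_eq, hX]
    rfl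
  have hv := (ineq163 L hL B hb hB k hk z).2.2.1
  have hvi := (ineq163 L hL B hb hB k hk (z + e κ)).2.2.2
  refine ⟨hid, hQ z κ, hv, hvi, ?_⟩
  -- the middle factor: ‖exp Q − 1‖ ≤ e^{2t} − 1 ≤ 4t
  have h2t1 : 2 * t ≤ 1 := by nlinarith
  have hU : ‖exp (logIter L B k z κ) - 1‖ ≤ 4 * t := by
    have h := (norm_exp_sub_one_le_of_norm_le (hQ z κ)).1
    have he : Real.exp (2 * t) - 1 ≤ 2 * (2 * t) := by
      have h' := Real.abs_exp_sub_one_le (x := 2 * t) (by rw [abs_of_nonneg (by positivity)]; exact h2t1)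
      rw [abs_of_nonneg (by positivity : (0 : ℝ) ≤ 2 * t)] at h'
      exact (le_abs_self _).trans h'
    linarith
  rw [hid]
  calc _ ≤ (1 + ‖(vprod L (expCfg B) k z : 𝔸) - 1‖) * (1 + ‖exp (logIter L B k z κ) - 1‖)
          * (1 + ‖(((vprod L (expCfg B) k (z + e κ))⁻¹ : 𝔸ˣ) : 𝔸) - 1‖) - 1 := norm_mul_mul_sub_one_le _ _ _
    _ ≤ 200 * ((d : ℝ) + 1) * t :=
        arith164 hd0 ht0 hsmall (norm_nonneg _) (norm_nonneg _) (norm_nonneg _) hv hU hvi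

/-- (164) at `U₀ = 1` in print's threshold letter: `L^kb ≤ c₄(d)` ⇒ `‖Ū′^k(c) − 1‖ ≤ 200(d+1)·L^kb`.
[cite: Balaban1985Averaging, Prop. 6 (164) p.43, Prop. 4 pp.38–39] -/
theorem prop6_flat_164 (L : ℕ) (hL : 2 ≤ L) (B : Site d → Fin d → 𝔸) {b : ℝ} (hb : 0 ≤ b)
    (hB : ∀ x κ, ‖B x κ‖ ≤ b) (k : ℕ) (hkb : (L : ℝ) ^ k * b ≤ c4 d) (z : Site d) (κ : Fin d) :
    ‖((avgIter L (expCfg B) k z κ : 𝔸ˣ) : 𝔸) - 1‖ ≤ 200 * ((d : ℝ) + 1) * ((L : ℝ) ^ k * b) := by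
  have hC1 := C1_pos d
  have hk : 8 * C1 d * ((L : ℝ) ^ k * b) ≤ 1 := by
    have h := mul_le_mul_of_nonneg_left hkb (by positivity : (0 : ℝ) ≤ 8 * C1 d)
    rwa [c4, mul_one_div_cancel (by positivity)] at h
  exact (prop6_flat L hL B hb hB k hk z κ).2.2.2.2

end Bounds

/-! ## §5 The analyticity clause of Proposition 6 at `U₀ = 1`: "\overline{U′U₀}^k is an analytic function of A′" -/

section Analytic

variable {𝔸 : Type*} [NormedRing 𝔸] [NormedAlgebra ℂ 𝔸] [CompleteSpace 𝔸]
variable {E : Type*} [NormedAddCommGroup E] [NormedSpace ℂ E]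

/-- The accumulated frame (160) AS A FUNCTION OF `A′` through the composites `Q_j(1, ·)` (127): `w_0 = 1`,
`w_{j+1}(z) = w_j(Lz) · v(Lz)[e^{Q_j(1, B)}]` — equal to `v_{j+1}[e^{B}]` under the smallness of Prop. 4
(`vprod_eq_vprodQ`), and the object whose analyticity is proved ("Proposition 4 implies that the functions of A in (159)
are analytic", p. 42). [cite: Balaban1985Averaging, (160) p.42, (127) p.37] -/
def vprodQ (L : ℕ) (B : Site d → Fin d → 𝔸) : ℕ → Site d → 𝔸ˣ
  | 0 => fun _ => 1
  | j + 1 => fun z => vprodQ L B j ((L : ℤ) • z) * vframe L (expCfg (logIter L B j)) ((L : ℤ) • z)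

/-- `vprodQ_zero`. [folklore] -/
@[simp] theorem vprodQ_zero (L : ℕ) (B : Site d → Fin d → 𝔸) (z : Site d) : vprodQ L B 0 z = 1 := rfl

/-- `vprodQ_succ`. [folklore] -/
theorem vprodQ_succ (L : ℕ) (B : Site d → Fin d → 𝔸) (j : ℕ) (z : Site d) :
    vprodQ L B (j + 1) z = vprodQ L B j ((L : ℤ) • z) * vframe L (expCfg (logIter L B j)) ((L : ℤ) • z) := rfl

/-- Under the smallness of Prop. 4 the two descriptions of the frames agree: `v_j[e^{B}] = w_j(B)` for `j ≤ k`
(because `U̿′^j = e^{Q_j}` bondwise, `B7Prop4Flat.prop4_flat_induction` (i)). [cite: Balaban1985Averaging, (160) p.42, (127) p.37] -/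
theorem vprod_eq_vprodQ (L : ℕ) (hL : 2 ≤ L) (B : Site d → Fin d → 𝔸) {b : ℝ} (hb : 0 ≤ b)
    (hB : ∀ x κ, ‖B x κ‖ ≤ b) (k : ℕ) (hk : 8 * C1 d * ((L : ℝ) ^ k * b) ≤ 1) :
    ∀ j ≤ k, vprod L (expCfg B) j = vprodQ L B j
  | 0, _ => rfl
  | j + 1, hj => by
    funext z
    rw [vprod_succ, vprodQ_succ, vprod_eq_vprodQ L hL B hb hB k hk j (Nat.le_of_succ_le hj),
      (ineq161 L hL B hb hB k hk (Nat.le_of_succ_le hj)).1]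

/-- **The right side of (159) at `U₀ = 1` as a function of `A′`**: `Ũ′^k(c) = w_k(c₋) · exp(Q_k(1, B)(c)) · w_k(c₊)⁻¹` —
the composite of analytic maps through which the analyticity of `Ū′^k` is read off. [cite: Balaban1985Averaging, (159) p.42] -/
def avgQ (L : ℕ) (B : Site d → Fin d → 𝔸) (k : ℕ) (z : Site d) (κ : Fin d) : 𝔸 :=
  (vprodQ L B k z : 𝔸) * exp (logIter L B k z κ) * (((vprodQ L B k (z + e κ))⁻¹ : 𝔸ˣ) : 𝔸)

/-- Under the smallness of Prop. 4, `Ū′^k(c)` IS the composite `avgQ` ((159) + `U̿′^k = e^{Q_k}` + `vprod_eq_vprodQ`).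
[cite: Balaban1985Averaging, (159) p.42, (127) p.37] -/
theorem avgIter_eq_avgQ (L : ℕ) (hL : 2 ≤ L) (B : Site d → Fin d → 𝔸) {b : ℝ} (hb : 0 ≤ b)
    (hB : ∀ x κ, ‖B x κ‖ ≤ b) (k : ℕ) (hk : 8 * C1 d * ((L : ℝ) ^ k * b) ≤ 1) (z : Site d) (κ : Fin d) :
    ((avgIter L (expCfg B) k z κ : 𝔸ˣ) : 𝔸) = avgQ L B k z κ := by
  rw [(prop6_flat L hL B hb hB k hk z κ).1, vprod_eq_vprodQ L hL B hb hB k hk k le_rfl]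
  rfl

/-- The frame exponents `F(q)[e^{Q_j(1, B(t))}]`, `j < k`, are analytic in any bondwise-analytic parametrisation `B(t)`
with `sup_b ‖B(t₀)_b‖ ≤ b`, `8C₁(d)L^kb ≤ 1` (`B7Prop3Flat.analyticAt_Favg_expCfg` on the domain supplied by (161)/(131):
`2L^jb ≤ c₃(d, L)`, `B7Prop3Flat.logDomain_of_le_c3`; `κ` is any direction, witnessing `d ≥ 1`).
[cite: Balaban1985Averaging, p.42 (after (163)), (131) p.38, (110) p.34] -/
theorem analyticAt_Favg_logIter (L : ℕ) (hL : 2 ≤ L) (B : E → Site d → Fin d → 𝔸) {t₀ : E}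
    (hBa : ∀ x κ, AnalyticAt ℂ (fun t => B t x κ) t₀) {b : ℝ} (hb : 0 ≤ b) (hB : ∀ x κ, ‖B t₀ x κ‖ ≤ b)
    (k : ℕ) (hk : 8 * C1 d * ((L : ℝ) ^ k * b) ≤ 1) {j : ℕ} (hj : j < k) (q : Site d) (κ : Fin d) :
    AnalyticAt ℂ (fun t => Favg L (expCfg (logIter L (B t) j)) q) t₀ := by
  have hL1 : 1 ≤ L := le_trans (by norm_num) hL
  have hL1r : (1 : ℝ) ≤ L := by exact_mod_cast hL1
  have hC1 := C1_pos d
  set s : ℝ := (L : ℝ) ^ j * b with hs_def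
  have hs0 : 0 ≤ s := by positivity
  have ht1 : 8 * C1 d * ((L : ℝ) * s) ≤ 1 := by
    have hLs : (L : ℝ) * s = (L : ℝ) ^ (j + 1) * b := by rw [hs_def, pow_succ]; ring
    have hmono : (L : ℝ) ^ (j + 1) * b ≤ (L : ℝ) ^ k * b :=
      mul_le_mul_of_nonneg_right (pow_le_pow_right₀ hL1r hj) hb
    rw [hLs]
    exact (mul_le_mul_of_nonneg_left hmono (by positivity)).trans hk
  have hac : 2 * s ≤ c3 d L := two_mul_le_c3_of_small L hL1 hs0 ht1
  have hA : ∀ x κ', ‖logIter L (B t₀) j x κ'‖ ≤ 2 * s := (prop4_flat_induction L hL (B t₀) hb hB k hk j hj.le).2.2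
  obtain ⟨-, hT, -, -⟩ := logDomain_of_le_c3 (expCfg (logIter L (B t₀) j)) (logIter L (B t₀) j) q
    (2 * (d * L) + L + L) (by positivity) (fun x κ' _ => ⟨rfl, hA x κ'⟩) L hL1 q κ (by simp [l1]) hac
  exact analyticAt_Favg_expCfg (fun t => logIter L (B t) j)
    (fun x κ' => prop4_flat_analyticAt L hL B hBa hb hB k hk j hj.le x κ') L q hT

/-- The accumulated frames `w_j(B(t))(z)` and their inverses, `j ≤ k`, are analytic at `t₀` (finite products of
`exp(±F)` with `F` analytic by `analyticAt_Favg_logIter`). [cite: Balaban1985Averaging, p.42 (after (163)), (160) p.42] -/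
theorem analyticAt_vprodQ (L : ℕ) (hL : 2 ≤ L) (B : E → Site d → Fin d → 𝔸) {t₀ : E}
    (hBa : ∀ x κ, AnalyticAt ℂ (fun t => B t x κ) t₀) {b : ℝ} (hb : 0 ≤ b) (hB : ∀ x κ, ‖B t₀ x κ‖ ≤ b)
    (k : ℕ) (hk : 8 * C1 d * ((L : ℝ) ^ k * b) ≤ 1) (κ : Fin d) :
    ∀ j ≤ k, ∀ z : Site d, AnalyticAt ℂ (fun t => ((vprodQ L (B t) j z : 𝔸ˣ) : 𝔸)) t₀ ∧
      AnalyticAt ℂ (fun t => (((vprodQ L (B t) j z)⁻¹ : 𝔸ˣ) : 𝔸)) t₀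
  | 0, _, z => by
    simp only [vprodQ_zero, inv_one, Units.val_one]
    exact ⟨analyticAt_const, analyticAt_const⟩
  | j + 1, hj, z => by
    have ih := analyticAt_vprodQ L hL B hBa hb hB k hk κ j (Nat.le_of_succ_le hj) ((L : ℤ) • z)
    have hF := analyticAt_Favg_logIter L hL B hBa hb hB k hk (Nat.lt_of_succ_le hj) ((L : ℤ) • z) κ
    simp only [vprodQ_succ, Units.val_mul, mul_inv_rev, vframe, val_inv_expUnit, val_expUnit]
    exact ⟨ih.1.fun_mul ((exp_analytic _).fun_comp_of_eq hF rfl),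
      ((exp_analytic _).fun_comp_of_eq hF.neg rfl).fun_mul ih.2⟩

/-- **PROPOSITION 6 OF B7 AT `U₀ = 1`, THE ANALYTICITY CLAUSE, parametrised form** ("\overline{U′U₀}^k is an analytic
function of A′ = (1/(iη)) log U′ for A′ with values in the complexified algebra, and satisfying |A′| < α₁"; proof p. 42:
"Proposition 4 implies that the functions of A in (159) are analytic"): for a bond field `B(t)` depending analytically
(bondwise) on `t` in any complex normed space `E`, with `sup_b ‖B(t₀)_b‖ ≤ b`, `8C₁(d)L^kb ≤ 1`, `L ≥ 2`, the composite
(159) `t ↦ w_k(c₋)·exp(Q_k(1, B(t))(c))·w_k(c₊)⁻¹` — which IS `Ū′^k(c)[e^{B(t)}]` wherever the smallness holds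
(`avgIter_eq_avgQ`) — is analytic at `t₀`. [cite: Balaban1985Averaging, Prop. 6 p.43, p.42 (after (163))] -/
theorem prop6_flat_analyticAt (L : ℕ) (hL : 2 ≤ L) (B : E → Site d → Fin d → 𝔸) {t₀ : E}
    (hBa : ∀ x κ, AnalyticAt ℂ (fun t => B t x κ) t₀) {b : ℝ} (hb : 0 ≤ b) (hB : ∀ x κ, ‖B t₀ x κ‖ ≤ b)
    (k : ℕ) (hk : 8 * C1 d * ((L : ℝ) ^ k * b) ≤ 1) (z : Site d) (κ : Fin d) :
    AnalyticAt ℂ (fun t => avgQ L (B t) k z κ) t₀ := by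
  have hv := analyticAt_vprodQ L hL B hBa hb hB k hk κ k le_rfl
  have hQ := prop4_flat_analyticAt L hL B hBa hb hB k hk k le_rfl z κ
  unfold avgQ
  exact ((hv z).1.fun_mul ((exp_analytic _).fun_comp_of_eq hQ rfl)).fun_mul (hv (z + e κ)).2

/-- **PROPOSITION 6 OF B7 AT `U₀ = 1`, THE ANALYTICITY CLAUSE IN THE PRINTED LETTER on `𝔸^S`**: for every finite set
`S` of bonds of the fine unit lattice, every `k`, every bond `c = ⟨z, z + e_κ⟩` of `Ω^{(k)} ≅ ℤ^d`, the function
`𝔸^S → 𝔸`, `(A′_b)_{b∈S} ↦ Ū′^k(c)` [`U′ = e^{A′}` on `S`, `U′ = 1` off `S`: `B7Prop3Flat.insCfg`] — the GENUINE `k`-fold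
average (43) `B7Prop2Explicit.avgIter` — is analytic on a neighbourhood of every point of the open polydisc
`{∀ b ∈ S, ‖A′_b‖ < c₄(d)/L^k}` (print: "|A′| < α₁", "α₀, α₁ sufficiently small"; on the unit lattice `L^k‖A′_b‖` plays
`|A′_b|` and `c₄(d) = 1/(8C₁(d))` is Prop. 4's threshold at `α₀ = 0`).  On the polydisc `Ū′^k(c)` coincides with the
composite (159) (`avgIter_eq_avgQ`), analytic by `prop6_flat_analyticAt`. [cite: Balaban1985Averaging, Prop. 6 p.43, (159) p.42] -/
theorem prop6_flat_analyticOnNhd_ins (S : Finset (Site d × Fin d)) (L : ℕ) (hL : 2 ≤ L) (k : ℕ)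
    (z : Site d) (κ : Fin d) :
    AnalyticOnNhd ℂ (fun a : S → 𝔸 => ((avgIter L (expCfg (insCfg S a)) k z κ : 𝔸ˣ) : 𝔸))
      {a | ∀ s, ‖a s‖ < c4 d / (L : ℝ) ^ k} := by
  have hL1 : 1 ≤ L := le_trans (by norm_num) hL
  have hmodel : AnalyticOnNhd ℂ (fun a : S → 𝔸 => avgQ L (insCfg S a) k z κ)
      {a | ∀ s, ‖a s‖ < c4 d / (L : ℝ) ^ k} := by
    intro a ha
    have hna : ‖a‖ < c4 d / (L : ℝ) ^ k := (pi_norm_lt_iff (c4_div_pow_pos d L hL1 k)).2 ha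
    exact prop6_flat_analyticAt L hL (fun a' : S → 𝔸 => insCfg S a') (fun x κ' => analyticAt_insCfg S x κ' a)
      (norm_nonneg a) (fun x κ' => norm_insCfg_le S a x κ') k (smallness_of_le_c4_div d L hL1 k hna.le) z κ
  refine hmodel.congr (isOpen_polydisc S _) fun a ha => ?_
  have hna : ‖a‖ < c4 d / (L : ℝ) ^ k := (pi_norm_lt_iff (c4_div_pow_pos d L hL1 k)).2 ha
  exact (avgIter_eq_avgQ L hL (insCfg S a) (norm_nonneg a) (fun x κ' => norm_insCfg_le S a x κ') k
    (smallness_of_le_c4_div d L hL1 k hna.le) z κ).symm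

/-- **PROPOSITION 6 OF B7 AT `U₀ = 1` on `𝔸^S`, the bound (164)** on the CLOSED polydisc `{∀ b ∈ S, ‖A′_b‖ ≤ c₄(d)/L^k}`:
`‖Ū′^k(c) − 1‖ ≤ 200(d+1)·L^k‖A′‖_∞` ("|\overline{U′U₀}^k(Ū^k_0)⁻¹ − 1| < O(1)α₁", `‖A′‖_∞ = sup_{b∈S} ‖A′_b‖`).
[cite: Balaban1985Averaging, Prop. 6 (164) p.43] -/
theorem prop6_flat_ins (S : Finset (Site d × Fin d)) (L : ℕ) (hL : 2 ≤ L) (k : ℕ) (z : Site d) (κ : Fin d)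
    {a : S → 𝔸} (ha : ∀ s, ‖a s‖ ≤ c4 d / (L : ℝ) ^ k) :
    ‖((avgIter L (expCfg (insCfg S a)) k z κ : 𝔸ˣ) : 𝔸) - 1‖ ≤ 200 * ((d : ℝ) + 1) * ((L : ℝ) ^ k * ‖a‖) := by
  have hL1 : 1 ≤ L := le_trans (by norm_num) hL
  have hL0 : 0 < L := hL1
  have hna : ‖a‖ ≤ c4 d / (L : ℝ) ^ k := (pi_norm_le_iff_of_nonneg (c4_div_pow_pos d L hL1 k).le).2 ha
  have hkb : (L : ℝ) ^ k * ‖a‖ ≤ c4 d := by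
    rw [mul_comm]; exact (le_div_iff₀ (by positivity)).1 hna
  exact prop6_flat_164 L hL (insCfg S a) (norm_nonneg a) (fun x κ' => norm_insCfg_le S a x κ') k hkb z κ

end Analytic

end Literature.MathematicalPhysics.QuantumFieldTheory.Balaban1983to89.B7Prop6Flat
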